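import Summits.QuantumFields.BalabanUV.T4Continuum.Support.TorusGaugeComb
import Summits.QuantumFields.BalabanUV.T4Continuum.Support.SmoothRefineAbelianFlux

/-!
# TorusLineHolonomy — BRICK B3a of the requested lattice lemma `torusSmallFieldGlobalGauge` (INTERFACE REQUEST NE7, route #1 of the NE7
# crux, stub S7 NODE O): LINE GEOMETRY on the discrete 4-torus — residue `r = x_μ mod M`, base `b = x − r·e_μ`, the straight transporter
# `P_r(b)` and the Polyakov holonomy `W(b)` of a periodic configuration; periodicity, constancy along the line, the TRANSVERSE RELATION
# `W(b + e_κ) = V(b,κ)⁻¹·Q_M⁻¹·W(b)·V(b,κ)` through the ladder holonomy; and PERIODIC REDUCTION of site predicates to the box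

Cell `pub-balaban`, rung (B)+1 sub-cell t4, lineage `b2b-balaban-t4-ne7-p1`, generation 26 (CRUX PROVER NE7 #1, ruling e34b3e0c); crux
skeleton `t4/skeletons/NE7-CRUX-R1.md` v1.7.6 §4 «INTERFACE REQUEST NE7» (HOME/INBOX.md ll.6031–6037); bricks B1 = `TorusGaugeComb` (p259900),
B2a = `UnitaryCayley` (p260933).  HONEST FRAMING (page 1): FIXED FINITE T⁴, rung (B)+1; NE7, NE3 NOT PRINTED in [Balaban1984PropagatorsI]–
[Balaban1989LargeFieldII] and NOT PROVED here; continuum YM on T⁴ ⇐ BetaPertH ∧ nine spine estimates (0/9 proved); BetaPertH ⇐ (D1) ∧ (D4) ∧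
CAP+tail; G-an2-4 gates asym, D1 and NE2/3/4; NOT infinite volume, NOT mass gap, NOT Clay.

WHAT ([folklore] lattice bookkeeping on `ℤ⁴` with `B7Prop1Explicit.hol`∕`seg`∕`ladder`):
 * §1 `periodic_shift` (four shifts ⟹ all of `M·ℤ⁴`, via `Function.Periodic`), `eq_wrapSite_add`, `wrapSite_eq_natSite`, **`periodic_reduce`**
   (an `M`-periodic site predicate holds everywhere once it holds on the box `natSite y`, `y_i < M`); `lineRes`∕`lineBase`∕`lineT`∕`holo` with
   `lineRes_bounds`, `lineBase_add` (`x = b + r·e_μ`), `lineRes_add_transverse`, `lineRes_add_period`, `lineRes_add_dir_interior`∕`_wrap`.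
 * §2 `holo_add_period`, **`holo_add_dir`** (the holonomy is constant along its line), `holo_add_transverse`, **`holo_transverse`**.
HONEST: elementary; nothing of Bałaban asserted; nothing of NE3∕NE7 discharged; 0 sorry.
-/

set_option autoImplicit false

open scoped BigOperators Matrix Matrix.Norms.L2Operator
open Finset NormedSpace

namespace Summit.QuantumFields.BalabanUV.T4Continuum.TorusLineHolonomy

open Literature.MathematicalPhysics.QuantumFieldTheory.Balaban1983to89
open B7Prop1Explicit B7Prop2Explicit
open T4AveragingDeficitWall hiding Site Plane Plaq Bond
open T4AveragingDeficitWallBoundary (IsPeriodicCfg)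
open NE3EnergyShapes (IsUnitarySite IsPeriodicSite)
open AveragingDeficitTransport (mem_U1_of_unitary)
open BlockAverageCurrent (smallField_gaugeAct)
open AveragingDeficitKDatum (isUnitaryCfg_gaugeAct)
open TorusGaugeComb (natSite wrapSite)
open SmoothRefineAbelianFlux (hol_add_period)

noncomputable section

/-! ## §1 Periodic reduction and line geometry on `ℤ⁴` -/

section Geometry

variable {G : Type*} [Group G] {β : Type*}

/-- A site function periodic under the four shifts `M·e_i` is periodic under every shift `M·v`, `v ∈ ℤ⁴`. [folklore] -/
theorem periodic_shift {f : Site 4 → β} {M : ℕ} (hf : ∀ (x : Site 4) (i : Fin 4), f (x + (M : ℤ) • e i) = f x) :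
    ∀ (v : Site 4) (x : Site 4), f (x + (M : ℤ) • v) = f x := by
  intro v
  have hp : ∀ i : Fin 4, Function.Periodic f ((M : ℤ) • e i) := fun i x => hf x i
  have hv : (M : ℤ) • v = ∑ i : Fin 4, (v i) • ((M : ℤ) • e i) := by
    conv_lhs => rw [← sum_zsmul_e v]
    rw [Finset.smul_sum]
    refine Finset.sum_congr rfl fun i _ => ?_
    rw [smul_comm]
  rw [hv, Fin.sum_univ_four]
  exact ((((hp 0).zsmul (v 0)).add_period ((hp 1).zsmul (v 1))).add_period ((hp 2).zsmul (v 2))).add_period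
    ((hp 3).zsmul (v 3))

/-- Every site is its reduction into the box plus `M` times an integer vector. [folklore] -/
theorem eq_wrapSite_add (M : ℕ) (x : Site 4) : x = wrapSite M x + (M : ℤ) • (fun i => x i / (M : ℤ)) := by
  funext i
  simp only [wrapSite, Pi.add_apply, Pi.smul_apply, smul_eq_mul]
  exact (Int.emod_add_mul_ediv (x i) (M : ℤ)).symm

/-- The reduced site lies in the box `[0, M)⁴` (`M ≥ 1`): it is `natSite y` with `y_i < M`. [folklore] -/
theorem wrapSite_eq_natSite {M : ℕ} (hM : 1 ≤ M) (x : Site 4) :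
    ∃ y : Fin 4 → ℕ, (∀ i, y i < M) ∧ wrapSite M x = natSite y ∧ ∀ i, (y i : ℤ) = x i % (M : ℤ) := by
  have hM0 : (0 : ℤ) < (M : ℤ) := by exact_mod_cast hM
  refine ⟨fun i => (x i % (M : ℤ)).toNat, fun i => ?_, ?_, fun i => ?_⟩
  · have h := Int.emod_lt_of_pos (x i) hM0
    have h0 := Int.emod_nonneg (x i) hM0.ne'
    have hc : (((x i % (M : ℤ)).toNat : ℕ) : ℤ) = x i % (M : ℤ) := Int.toNat_of_nonneg h0
    have : (((x i % (M : ℤ)).toNat : ℕ) : ℤ) < (M : ℤ) := by rw [hc]; exact h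
    exact_mod_cast this
  · funext i
    simp only [wrapSite, natSite]
    rw [Int.toNat_of_nonneg (Int.emod_nonneg (x i) hM0.ne')]
  · exact Int.toNat_of_nonneg (Int.emod_nonneg (x i) hM0.ne')

/-- **PERIODIC REDUCTION**: a statement about all box sites `natSite y`, `y_i < M`, of an `M`-periodic site predicate holds at every site.
[folklore] -/
theorem periodic_reduce {M : ℕ} (hM : 1 ≤ M) {p : Site 4 → Prop} (hp : ∀ (x : Site 4) (i : Fin 4), p (x + (M : ℤ) • e i) ↔ p x)
    (hbox : ∀ y : Fin 4 → ℕ, (∀ i, y i < M) → p (natSite y)) (x : Site 4) : p x := by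
  obtain ⟨y, hy, hwrap, _⟩ := wrapSite_eq_natSite hM x
  have hper : ∀ (v : Site 4) (z : Site 4), p (z + (M : ℤ) • v) = p z := periodic_shift (f := p) fun z i => propext (hp z i)
  rw [eq_wrapSite_add M x, hper, hwrap]
  exact hbox y hy

variable (M : ℕ) (μ : Fin 4)

/-- The residue `r = x_μ mod M ∈ [0, M)`. [folklore] -/
def lineRes (x : Site 4) : ℤ := x μ % (M : ℤ)

/-- The BASE of the `μ`-line through `x`: `b = x − r·e_μ` (its `μ`-coordinate is a multiple of `M`). [folklore] -/
def lineBase (x : Site 4) : Site 4 := x - lineRes M μ x • e μ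

/-- The straight transporter `P_r(b) = V(b → x)` along the `μ`-line. [folklore] -/
def lineT (V : Site 4 → Fin 4 → G) (x : Site 4) : G := hol V (lineBase M μ x) (seg μ (lineRes M μ x))

/-- The holonomy (Polyakov loop) `W(b) = V(b → b + M·e_μ)` of the `μ`-line through `x`. [folklore] -/
def holo (V : Site 4 → Fin 4 → G) (x : Site 4) : G := hol V (lineBase M μ x) (seg μ (M : ℤ))

variable {M μ}

/-- `0 ≤ r < M`. [folklore] -/
theorem lineRes_bounds (hM : 1 ≤ M) (x : Site 4) : 0 ≤ lineRes M μ x ∧ lineRes M μ x < (M : ℤ) := by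
  have hM0 : (0 : ℤ) < (M : ℤ) := by exact_mod_cast hM
  exact ⟨Int.emod_nonneg _ hM0.ne', Int.emod_lt_of_pos _ hM0⟩

/-- `x = b + r·e_μ`. [folklore] -/
theorem lineBase_add (x : Site 4) : lineBase M μ x + lineRes M μ x • e μ = x := by
  simp [lineBase]

/-- Transverse steps do not change the residue and shift the base: `κ ≠ μ`. [folklore] -/
theorem lineRes_add_transverse {κ : Fin 4} (hκ : κ ≠ μ) (x : Site 4) :
    lineRes M μ (x + e κ) = lineRes M μ x ∧ lineBase M μ (x + e κ) = lineBase M μ x + e κ := by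
  have h1 : (x + e κ) μ = x μ := by simp [e, hκ.symm]
  have hr : lineRes M μ (x + e κ) = lineRes M μ x := by simp only [lineRes, h1]
  refine ⟨hr, ?_⟩
  simp only [lineBase, hr]
  abel

/-- Periodic shifts do not change the residue and shift the base. [folklore] -/
theorem lineRes_add_period (x : Site 4) (i : Fin 4) :
    lineRes M μ (x + (M : ℤ) • e i) = lineRes M μ x ∧ lineBase M μ (x + (M : ℤ) • e i) = lineBase M μ x + (M : ℤ) • e i := by
  have hcoord : (x + (M : ℤ) • e i) μ = x μ + (M : ℤ) * e i μ := by simp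
  have hr : lineRes M μ (x + (M : ℤ) • e i) = lineRes M μ x := by
    unfold lineRes
    rw [hcoord, e_apply]
    by_cases h : μ = i
    · rw [if_pos h, Int.add_mul_emod_self_left]
    · rw [if_neg h, mul_zero, add_zero]
  refine ⟨hr, ?_⟩
  simp only [lineBase, hr]
  abel

/-- The step `+e_μ` INSIDE the line (`r + 1 < M`): same base, residue `r + 1`. [folklore] -/
theorem lineRes_add_dir_interior (hM : 1 ≤ M) (x : Site 4) (h : lineRes M μ x + 1 < (M : ℤ)) :
    lineRes M μ (x + e μ) = lineRes M μ x + 1 ∧ lineBase M μ (x + e μ) = lineBase M μ x := by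
  have h0 := (lineRes_bounds (μ := μ) hM x).1
  have hr : lineRes M μ (x + e μ) = lineRes M μ x + 1 := by
    simp only [lineRes, Pi.add_apply, e, Pi.single_eq_same] at h h0 ⊢
    have e1 : x μ + 1 = (x μ % (M : ℤ) + 1) + (M : ℤ) * (x μ / (M : ℤ)) := by
      have := Int.emod_add_mul_ediv (x μ) (M : ℤ)
      omega
    rw [e1, Int.add_mul_emod_self_left, Int.emod_eq_of_lt (by omega) h]
  refine ⟨hr, ?_⟩
  simp only [lineBase, hr, add_smul, one_smul]
  abel

/-- The step `+e_μ` ACROSS the wrap (`r = M − 1`): residue `0`, base shifted by `M·e_μ`. [folklore] -/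
theorem lineRes_add_dir_wrap (x : Site 4) (h : lineRes M μ x + 1 = (M : ℤ)) :
    lineRes M μ (x + e μ) = 0 ∧ lineBase M μ (x + e μ) = lineBase M μ x + (M : ℤ) • e μ := by
  have hr : lineRes M μ (x + e μ) = 0 := by
    simp only [lineRes, Pi.add_apply, e, Pi.single_eq_same] at h ⊢
    have e1 : x μ + 1 = (M : ℤ) * (x μ / (M : ℤ) + 1) := by
      have := Int.emod_add_mul_ediv (x μ) (M : ℤ)
      rw [mul_add, mul_one]
      omega
    rw [e1, Int.mul_emod_right]
  refine ⟨hr, ?_⟩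
  simp only [lineBase, hr, zero_smul, sub_zero]
  rw [← h, add_smul, one_smul]
  abel

end Geometry

/-! ## §2 Holonomies of a periodic configuration: periodicity, constancy along the line, the transverse relation -/

section Holonomy

variable {G : Type*} [Group G] {M : ℕ} {μ : Fin 4}

/-- The holonomy is `M`-periodic in the site. [folklore] -/
theorem holo_add_period {V : Site 4 → Fin 4 → G} (hV : ∀ (y : Site 4) (κ ν : Fin 4), V (y + (M : ℤ) • e κ) ν = V y ν)
    (x : Site 4) (i : Fin 4) : holo M μ V (x + (M : ℤ) • e i) = holo M μ V x := by
  simp only [holo, (lineRes_add_period x i).2, hol_add_period V hV]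

/-- The holonomy is CONSTANT along the line: `W(x + e_μ) = W(x)`. [folklore] -/
theorem holo_add_dir (hM : 1 ≤ M) {V : Site 4 → Fin 4 → G} (hV : ∀ (y : Site 4) (κ ν : Fin 4), V (y + (M : ℤ) • e κ) ν = V y ν)
    (x : Site 4) : holo M μ V (x + e μ) = holo M μ V x := by
  rcases lt_or_eq_of_le (show lineRes M μ x + 1 ≤ (M : ℤ) by have := (lineRes_bounds (μ := μ) hM x).2; omega) with h | h
  · simp only [holo, (lineRes_add_dir_interior hM x h).2]
  · simp only [holo, (lineRes_add_dir_wrap x h).2, hol_add_period V hV]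

/-- Transverse steps: `W(x + e_κ) = V(b + e_κ → …)` is the holonomy based at `b + e_κ`. [folklore] -/
theorem holo_add_transverse {κ : Fin 4} (hκ : κ ≠ μ) (V : Site 4 → Fin 4 → G) (x : Site 4) :
    holo M μ V (x + e κ) = hol V (lineBase M μ x + e κ) (seg μ (M : ℤ)) := by
  simp only [holo, (lineRes_add_transverse hκ x).2]

/-- **THE TRANSVERSE RELATION**: with `B = V(b, κ)` and the ladder holonomy `Q_M = V(ladder_M)` based at `b`,
`Q_M = W(b)·B·W(b + e_κ)⁻¹·B⁻¹`, i.e. `W(b + e_κ) = B⁻¹·Q_M⁻¹·W(b)·B` (periodicity `V(b + M e_μ, κ) = V(b, κ)`). [folklore] -/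
theorem holo_transverse {κ : Fin 4} (hκ : κ ≠ μ) {V : Site 4 → Fin 4 → G}
    (hV : ∀ (y : Site 4) (κ' ν : Fin 4), V (y + (M : ℤ) • e κ') ν = V y ν) (x : Site 4) :
    holo M μ V (x + e κ) = (V (lineBase M μ x) κ)⁻¹ * (hol V (lineBase M μ x) (ladder (seg μ (M : ℤ)) κ))⁻¹ *
      holo M μ V x * V (lineBase M μ x) κ := by
  rw [holo_add_transverse hκ, hol_ladder, disp_seg, hV, holo]
  group

end Holonomy

end

end Summit.QuantumFields.BalabanUV.T4Continuum.TorusLineHolonomy
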